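import Literature.AlgebraicGeometry.Resolution.ArithmeticalThreefoldsDescentComposite
import Literature.AlgebraicGeometry.Resolution.ArithmeticalThreefolds
import HarnessLib

/-!
# Cossart–Piltant 2019, Prop. 4.8: Novacoski–Spivakovsky's residual hypothesis `h₂` from (LU)
# for the quotient `Â/P∞`

Topic: `Literature/AlgebraicGeometry/Resolution` (proofs only; no new notions, no new named
facts). The composite route to the regular model with `K`-finite denominators
(`ArithmeticalThreefoldsDescentComposite.lean`) consumes Novacoski–Spivakovsky's hypothesis
`h₂` (arXiv:1204.4751v1, Cor. 2.17): a finitely generated regular model of the residual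
valuation `ν₂` above the residue ring `R̄/P∞` of the model `R̄ = im(R → K̂₁)`, inside ANY field
`κ → κ(O₁)` containing it as a ring of fractions. Here `h₂` is DERIVED from Cossart–Piltant's
property (LU) (`CPLocalUniformization`, CP 2019 §4.1) of the local domains that are quotients of
`R` by `P∞ = {a | v̂(a) is K-infinitesimal}` — for `R = Â` these are the complete local domains
`Â/P∞`:

* `residualLU_of_cpLocalUniformization` — `h₂` for `(O', O₁, ⊥)` from
  `CPLocalUniformization D` for every local domain `D` receiving a surjection `π : R ↠ D` with
  `ker π = P∞`, given that `O'` dominates `R` with residues algebraic over it.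

The point: the residual valuation ring `(O'/𝔪_{O₁}) ∩ κ` contains and dominates `φ(R̄) ≅ R/P∞`,
with residues algebraic over it (they are residues of `O'`), so (LU) for `φ(R̄)` applies; the
model `φ(R̄)[s]` it returns is `R[s]` as an `R`-subalgebra of `κ`.

## Sources

* V. Cossart, O. Piltant, J. Algebra 529 (2019) 268–535 = arXiv:1412.0868, §4.1 (LU) and proof
  of Prop. 4.8 (arXiv v1: Prop. 4.6, pp. 52–53). [CossartPiltant2019]
* J. Novacoski, M. Spivakovsky, arXiv:1204.4751v1, Lemma 2.3, Cor. 2.17. [NovacoskiSpivakovsky2014]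
-/

noncomputable section

namespace Literature.AlgebraicGeometry.Resolution

universe u

open IsLocalRing Function _root_.Polynomial

section ResidualLU

variable {R : Type u} [CommRing R] [IsLocalRing R] {K K₁ : Type u} [Field K] [Field K₁]
  [Algebra R K₁]

/-- In a pulled-back valuation ring `S.comap f`, an element is a non-unit iff its image is a
non-unit of `S`. [folklore] -/
private theorem valuation_comap_lt_one_iff_of_mem {L : Type u} [Field L] (S : ValuationSubring K₁)
    (f : L →+* K₁) (z : L) (hz : z ∈ S.comap f) :
    (S.comap f).valuation z < 1 ↔ S.valuation (f z) < 1 := by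
  have h1 := not_valuation_lt_one_iff (S.comap f) ⟨z, hz⟩
  have h2 := not_valuation_lt_one_iff S ⟨f z, hz⟩
  have h3 := isUnit_comap_iff S f z hz
  rw [← not_iff_not]
  exact (h1.trans h3).trans h2.symm


set_option maxHeartbeats 1600000 in
/-- **Novacoski–Spivakovsky's `h₂` from Cossart–Piltant's (LU) for `R/P∞`.** Let `R` be a local
ring mapping to a field `K̂₁`, `O' ≤ O₁` valuation rings of `K̂₁` with `R̄ = im R ⊆ O'`, `O'`
dominating `R` with residues algebraic over `R` (elementary form). Suppose every local domain
`D` receiving a surjection `π : R ↠ D` whose kernel is the centre of `O₁` on `R` has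
Cossart–Piltant's property (LU) (`CPLocalUniformization D`). Then hypothesis `h₂` of
`novacoskiSpivakovsky2014_cor217` holds for the model `⊥ = R̄`: for every field `κ` with
`j : κ → κ(O₁)` and `φ : R̄ →ₐ[R] κ` compatible with the residue map and `κ = Frac φ(R̄)`,
some finitely generated `R`-subalgebra `B ⊇ φ(R̄)` of `κ` lies in the residual valuation ring
`(O'/𝔪_{O₁}) ∩ κ` and is regular at its centre. Proof: `φ(R̄) ≅ R/P∞` receives `π`; the
residual valuation ring contains and dominates it with residues algebraic over it (residues of
`O'`, Novacoski–Spivakovsky Lemma 2.3); (LU) gives `φ(R̄)[s]`, which is `R[s]`.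
[cite: CossartPiltant2019, §4.1 (LU) and proof of Prop. 4.8 (arXiv v1: Prop. 4.6, pp. 52–53)]
[cite: NovacoskiSpivakovsky2014, Lemma 2.3 and Cor. 2.17] -/
theorem residualLU_of_cpLocalUniformization
    (O' O₁ : ValuationSubring K₁) (hO : O' ≤ O₁)
    (hbot : (⊥ : Subalgebra R K₁).toSubring ≤ O'.toSubring)
    (hdomR : ∀ x ∈ maximalIdeal R, O'.valuation (algebraMap R K₁ x) < 1)
    (halgR : ∀ y : O', ∃ p : R[X], (∃ i, p.coeff i ∉ maximalIdeal R) ∧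
      O'.valuation (p.eval₂ (algebraMap R K₁) y) < 1)
    (hLU : ∀ (D : Type u) [CommRing D] [IsDomain D] [IsLocalRing D] (π : R →+* D),
      Function.Surjective π → (∀ a : R, π a = 0 ↔ O₁.valuation (algebraMap R K₁ a) < 1) →
      CPLocalUniformization D) :
    ∀ (κ : Type u) [Field κ] [Algebra R κ] (j : κ →+* ResidueField O₁)
      (φ : (⊥ : Subalgebra R K₁) →ₐ[R] κ),
      (∀ a : (⊥ : Subalgebra R K₁), j (φ a) = residue O₁ ⟨(a : K₁), (hbot.trans hO) a.2⟩) →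
      IsFractionRing φ.range κ →
      ∃ (B : Subalgebra R κ)
        (hB : B.toSubring ≤ ((residueValuationSubring O' O₁ hO).comap j).toSubring),
        φ.range ≤ B ∧ B.FG ∧
        IsRegularLocalRing (Localization.AtPrime
          ((maximalIdeal ((residueValuationSubring O' O₁ hO).comap j)).comap
            (Subring.inclusion hB))) := by
  intro κ _ _ j φ hjφ hfrac
  classical
  set O₂ := residueValuationSubring O' O₁ hO with hO₂def
  set W : ValuationSubring κ := O₂.comap j with hWdef
  set D : Subalgebra R κ := φ.range with hDdef
  have hRbot : ∀ r : R, algebraMap R K₁ r ∈ (⊥ : Subalgebra R K₁) := fun r =>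
    Algebra.mem_bot.mpr ⟨r, rfl⟩
  have hRO' : ∀ r : R, algebraMap R K₁ r ∈ O' := fun r => hbot (hRbot r)
  have hRO₁ : ∀ r : R, algebraMap R K₁ r ∈ O₁ := fun r => hO (hRO' r)
  -- `φ` on the generators: `φ (algebraMap R ⊥ r) = algebraMap R κ r`
  have hφalg : ∀ r : R, φ ⟨algebraMap R K₁ r, hRbot r⟩ = algebraMap R κ r := fun r => by
    have : (⟨algebraMap R K₁ r, hRbot r⟩ : (⊥ : Subalgebra R K₁)) =
        algebraMap R (⊥ : Subalgebra R K₁) r := Subtype.ext rfl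
    rw [this, AlgHom.commutes]
  have hjalg : ∀ r : R, j (algebraMap R κ r) = residue O₁ ⟨algebraMap R K₁ r, hRO₁ r⟩ :=
    fun r => by rw [← hφalg, hjφ]
  -- the surjection `π : R ↠ D = φ(R̄)`
  have hDmem : ∀ r : R, algebraMap R κ r ∈ D := fun r => ⟨⟨algebraMap R K₁ r, hRbot r⟩, hφalg r⟩
  have hDsurj : ∀ d : D, ∃ r : R, algebraMap R κ r = (d : κ) := by
    rintro ⟨d, ⟨⟨x, hx⟩, rfl⟩⟩
    obtain ⟨r, rfl⟩ := Set.mem_range.mp (Algebra.mem_bot.mp hx)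
    exact ⟨r, (hφalg r).symm⟩
  let π : R →+* D := (algebraMap R κ).codRestrict D hDmem
  have hπval : ∀ r : R, ((π r : D) : κ) = algebraMap R κ r := fun _ => rfl
  have hπ : Function.Surjective π := fun d => by
    obtain ⟨r, hr⟩ := hDsurj d
    exact ⟨r, Subtype.ext hr⟩
  haveI : IsLocalRing D := IsLocalRing.of_surjective' π hπ
  -- kernel of `π` = centre of `O₁`
  have hker : ∀ a : R, π a = 0 ↔ O₁.valuation (algebraMap R K₁ a) < 1 := by
    intro a
    rw [← ValuationSubring.valuation_lt_one_iff O₁ ⟨algebraMap R K₁ a, hRO₁ a⟩,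
      ← residue_eq_zero_iff, ← hjalg, map_eq_zero_iff j j.injective]
    constructor
    · intro h
      rw [← hπval a, h]
      rfl
    · intro h
      exact Subtype.ext (by rw [hπval, h]; rfl)
  have hD : CPLocalUniformization D := hLU D π hπ hker
  -- `D ⊆ W`, dominated, residues algebraic
  haveI : IsFractionRing D κ := hfrac
  have hDval : ∀ d : D, algebraMap D κ d = (d : κ) := fun _ => rfl
  have hWmem : ∀ (z : κ) (y : K₁) (hy : y ∈ O'), j z = residue O₁ ⟨y, hO hy⟩ → z ∈ W := by
    intro z y hy hjz
    rw [hWdef, ValuationSubring.mem_comap, hjz, hO₂def, residue_mem_residueValuationSubring_iff]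
    exact hy
  have hWval : ∀ (z : κ) (y : K₁) (hy : y ∈ O') (hjz : j z = residue O₁ ⟨y, hO hy⟩),
      W.valuation z < 1 ↔ O'.valuation y < 1 := by
    intro z y hy hjz
    rw [valuation_comap_lt_one_iff_of_mem O₂ j z (hWmem z y hy hjz), hjz,
      ← valuation_lt_one_iff_residue O' O₁ hO y hy]
  have hDW : ∀ d : D, algebraMap D κ d ∈ W := by
    intro d
    obtain ⟨r, hr⟩ := hDsurj d
    exact hWmem _ (algebraMap R K₁ r) (hRO' r) (by rw [hDval, ← hr, hjalg])
  have hdomD : ∀ d ∈ maximalIdeal D, W.valuation (algebraMap D κ d) < 1 := by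
    intro d hd
    obtain ⟨r, rfl⟩ := hπ d
    have hr : r ∈ maximalIdeal R := by
      by_contra hr
      have hu : IsUnit r := by
        by_contra hnu; exact hr ((IsLocalRing.mem_maximalIdeal _).mpr (mem_nonunits_iff.mpr hnu))
      exact (mem_nonunits_iff.mp ((IsLocalRing.mem_maximalIdeal _).mp hd)) (hu.map π)
    rw [hWval _ (algebraMap R K₁ r) (hRO' r) (by rw [hDval, hπval, hjalg])]
    exact hdomR r hr
  -- evaluation bookkeeping along `R → O' → O₁ → κ(O₁)` and `R → D → κ → κ(O₁)`
  let ρ' : R →+* O' := (algebraMap R K₁).codRestrict O' hRO'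
  let ρ : R →+* O₁ := (algebraMap R K₁).codRestrict O₁ hRO₁
  have hρ'val : O'.subtype.comp ρ' = algebraMap R K₁ := RingHom.ext fun _ => rfl
  have hρincl : (O'.inclusion O₁ hO).comp ρ' = ρ := RingHom.ext fun _ => rfl
  have hρj : j.comp (algebraMap R κ) = (residue O₁).comp ρ := RingHom.ext fun r => by
    simp only [RingHom.comp_apply, hjalg]; rfl
  have hπalg : (algebraMap D κ).comp π = algebraMap R κ := RingHom.ext fun _ => rfl
  have halgD : ∀ w : W, ∃ q : D[X], (∃ i, q.coeff i ∉ maximalIdeal D) ∧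
      W.valuation (q.eval₂ (algebraMap D κ) w) < 1 := by
    intro w
    have hw : j (w : κ) ∈ O₂ := (ValuationSubring.mem_comap).mp w.2
    obtain ⟨y, hy⟩ := (mem_residueValuationSubring_iff O' O₁ hO _).mp hw
    obtain ⟨p, ⟨i, hi⟩, hv⟩ := halgR y
    refine ⟨p.map π, ⟨i, ?_⟩, ?_⟩
    · rw [Polynomial.coeff_map]
      have hu : IsUnit (p.coeff i) := by
        by_contra hnu
        exact hi ((IsLocalRing.mem_maximalIdeal _).mpr (mem_nonunits_iff.mpr hnu))
      intro hm
      exact (mem_nonunits_iff.mp ((IsLocalRing.mem_maximalIdeal _).mp hm)) (hu.map π)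
    · -- the element `e' = p(y) ∈ O'` and its residue
      set e' : O' := p.eval₂ ρ' y with he'def
      have he'val : (e' : K₁) = p.eval₂ (algebraMap R K₁) (y : K₁) := by
        rw [he'def, ← hρ'val]
        exact (Polynomial.hom_eval₂ p ρ' O'.subtype y)
      have hz : (p.map π).eval₂ (algebraMap D κ) (w : κ) = p.eval₂ (algebraMap R κ) (w : κ) := by
        rw [Polynomial.eval₂_map, hπalg]
      have hjz : j (p.eval₂ (algebraMap R κ) (w : κ)) = residue O₁ ⟨(e' : K₁), hO e'.2⟩ := by
        rw [Polynomial.hom_eval₂ p (algebraMap R κ) j (w : κ), hρj, ← hy,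
          ← Polynomial.hom_eval₂ p ρ (residue O₁)]
        congr 1
        have h1 : (⟨(e' : K₁), hO e'.2⟩ : O₁) = (O'.inclusion O₁ hO) e' := Subtype.ext rfl
        rw [h1, he'def]
        have := Polynomial.hom_eval₂ p ρ' (O'.inclusion O₁ hO) y
        rw [hρincl] at this
        exact this.symm
      rw [hz, hWval _ (e' : K₁) e'.2 hjz, he'val]
      exact hv
  -- (LU) for `D` at `W`
  obtain ⟨sD, hsD, hregD⟩ := hD κ W hDW hdomD halgD
  -- the model `B = R[s] = D[s]`
  let B : Subalgebra R κ := Algebra.adjoin R (sD : Set κ)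
  have hrangeD : Set.range (algebraMap D κ) = Set.range (algebraMap R κ) := by
    ext z
    constructor
    · rintro ⟨d, rfl⟩
      obtain ⟨r, hr⟩ := hDsurj d
      exact ⟨r, hr⟩
    · rintro ⟨r, rfl⟩
      exact ⟨π r, rfl⟩
  have hBeq : B.toSubring = (Algebra.adjoin D (sD : Set κ)).toSubring := by
    rw [Algebra.adjoin_eq_ring_closure, Algebra.adjoin_eq_ring_closure, hrangeD]
  have hB : B.toSubring ≤ W.toSubring := by rw [hBeq]; exact hsD
  refine ⟨B, hB, ?_, Subalgebra.fg_adjoin_finset _, ?_⟩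
  · intro z hz
    obtain ⟨r, hr⟩ := hDsurj ⟨z, hz⟩
    change algebraMap R κ r = z at hr
    rw [← hr]
    exact B.algebraMap_mem r
  · have h1 := (isRegularLocalRing_locAtCentre_iff hsD).mpr hregD
    have h2 : locAtCentre B.toSubring W = locAtCentre (Algebra.adjoin D (sD : Set κ)).toSubring W := by
      rw [hBeq]
    rw [← h2] at h1
    exact (isRegularLocalRing_locAtCentre_iff hB).mp h1

end ResidualLU

end Literature.AlgebraicGeometry.Resolution

end
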